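import Summits.QuantumFields.Balaban3D.Carriers.Standard
import Literature.MathematicalPhysics.QuantumFieldTheory.Balaban1983to89.T4AxialGaugeFixing
import Summits.QuantumFields.Balaban3D.Proofs.Bound55Tower
import Summits.QuantumFields.Balaban3D.Proofs.Bound55Masses

/-!
# `Summit.QuantumFields.Balaban3D.Proofs.Bound55Std` — C1 `Bound55` / C2 `Bound55Lower` AT THE LANE'S STANDARD TOWER INPUT
# `Carriers.stdTowerInput X K 𝔖` (ruling R-E4‴: the end theorem's `mkT G 𝔊 S := towerWith (stdTowerInput …) ⊤`), with every
# STRUCTURAL hypothesis of `…Proofs.Bound55Tower` DISCHARGED by name — masses (seat p1's `histWeights3`, v1.2 pins), decomposition of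
# unity (`Bound55Masses`), measurability + Haar compatibility of `Ū` (`ExternalInputs.av_meas`/`av_map`, E6′), `lower ≤ upper`
# (`massRec_triv`) — leaving EXACTLY the (β) fibre inequalities `hfibre`/`hfibreLow`, the integrability of the (41)_k/(47)_k sides, the
# barrier pinning (`rfl` for seat p3's pieces: p1 `stdTowerInput_upper/_lower`) and `Rm_k ≥ 0`; the (β) hypotheses ARE the lane's two booked
# RESIDUALS R3D-01 `Fibre49` / R3D-02 `Fibre57Low` (ruling R-FIBRE, lead batch 18), DEFINED here as Props (seat p4 = owner of the text)
# — lane `pub-balaban3d`, seat p4 (LEAF-LEDGER C1/C2)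

HONEST FRAMING (lane PLAN.md §0, binding): see `…Proofs.SectAFirstStep` and HOME/drafts/p4/FIBRE49.md.  Bookkeeping over seats p1/p4;
the (β) content of (49)–(58) / (12)–(22) is the hypothesis `hfibre` (per new history) / `hfibreLow` (trivial history).
-/

noncomputable section

namespace Summit.QuantumFields.Balaban3D.Proofs.Bound55Std

open _root_.MeasureTheory
open Literature.MathematicalPhysics.QuantumFieldTheory.Balaban1983to89
open Literature.MathematicalPhysics.QuantumFieldTheory.Balaban1983to89.AveragingRT (rnTransport)
open Literature.MathematicalPhysics.QuantumFieldTheory.Balaban1983to89.B10SectAGathering (StepPieces Bound55 Bound55Lower)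
open Literature.MathematicalPhysics.QuantumFieldTheory.Balaban1985CMP102
open Literature.MathematicalPhysics.QuantumFieldTheory.Balaban1985CMP102.Setting
open Summit.QuantumFields.Balaban3D.Carriers
open Summit.QuantumFields.Balaban3D.Proofs.Bound55Tower
open Summit.QuantumFields.Balaban3D.Proofs.Bound55Masses

variable {L : ℕ} {S : Scales L} {G : Type} [GaugeGroup G] [MeasurableSpace G] [HaarData G] [RegularGaugeGroup G]
  {V : Type} [NormedAddCommGroup V] [NormedSpace ℂ V]
  (X : ExternalInputs S G) (K : CarrierConsts) (𝔖 : ∀ k, StepSeries S G V (nblkOf S K k) k) (slot : ℕ → Prop) (k : ℕ)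

/-! ## The two booked (β) RESIDUALS of the lane (ruling R-FIBRE, lead batch 18): R3D-01 `Fibre49`, R3D-02 `Fibre57Low` -/

/-- **RESIDUAL R3D-01 `Fibre49` — «The integral (49)» ≤ (51) ≤ (55)·(58)** ([Balaban1985UV3] pp. 268–270; at k = 0 the chain (12)→(22)
pp. 259–261), in TRANSPORTED form at the lane's standard tower, for the new history `h′` of step `k`: the Radon–Nikodym transport over
`Ū_k` of the (41)_k integrand of the old history `proj h′`, weighted by the decomposition-of-unity step weight `w(h′)` and the small-field
factor `χB(h′)` inside `B(Λ_{k+1}(h′))` AT THE DECOMPOSITION THRESHOLD `ε₁ = g_kp(g_k)` of the step (`eps1Of`; text layer p. 267 L35–37 «We introduce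
the decomposition of unity (7) for the field V on the domain Λ_k, with ε₁ = g_kp(g_k)», p. 268 L13–15 «The symbol χ denotes characteristics functions in
the decomposition of unity, restricted to B(Λ_{k+1}), i.e. determining the small fields restrictions» — v4: v1–v3 had `εS = 2L²g_{k−1}p(g_{k−1})` here, which
makes this residual at `h′ = triv` and R3D-02 jointly unsatisfiable, seat p4 FINDING `…Proofs.FibreClash`, ruling R-FIBRE′; print-exact now, referee
F-59 (c)), is dV-a.e. at most the transport of `w(h′)·m_k(proj h′)` (the next mass, (48)) times
`exp[(55)+(58) exponent]` read off the step pieces `P`.  For the standard averaging both sides are explicit Haar integrals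
`∫ ·(axialParam V W) dW` (`AxialFibre.rnTransport_axial_ae_eq`).  A (β) ρ-display ASSUMED, not proved (status RESIDUAL, LEAF-LEDGER §F F5);
its discharge is seat p4's STEP-4 programme (HOME/drafts/p4/FIBRE49.md F1–F8). [cite: Balaban1985UV3, (49)–(58) pp.268–270 + (12)–(22) pp.259–261] -/
def Fibre49 (P : StepPieces ((stdTowerInput X K 𝔖).towerWith slot).toTowerRun k) (h' : Hist S.P (k + 1)) : Prop :=
  (rnTransport (X.av k).avg (fun U =>
    stepWeight K.M₁ (rcolOf S K) (eps1Of S K) (epsSOf S K) k h' U * chiB K.M₁ (rcolOf S K) (eps1Of S K) k h' U *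
      ((stdTowerInput X K 𝔖).W.mass k h'.proj U *
        Real.exp (-(((stdTowerInput X K 𝔖).towerWith slot).mainT k h'.proj U) + (stdTowerInput X K 𝔖).Pint k h'.proj U
          - ((stdTowerInput X K 𝔖).towerWith slot).Ecst k
          + ((stdTowerInput X K 𝔖).towerWith slot).Zterm k h'.proj + ((stdTowerInput X K 𝔖).towerWith slot).Rm k))))
  ≤ᵐ[fieldMeasure S.P (k + 1) G] fun V =>
    rnTransport (X.av k).avg (fun U =>
      stepWeight K.M₁ (rcolOf S K) (eps1Of S K) (epsSOf S K) k h' U * (stdTowerInput X K 𝔖).W.mass k h'.proj U) V *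
    Real.exp (-(((stdTowerInput X K 𝔖).towerWith slot).mainT (k + 1) h' V) - ((stdTowerInput X K 𝔖).towerWith slot).Ecst k
      + (P.logσ₀ + P.dg * Real.log (S.gk k)) * P.starB h' + P.logZU h' V + P.Pold h' V
      + ((stdTowerInput X K 𝔖).towerWith slot).Zterm k (P.proj h') + ((stdTowerInput X K 𝔖).towerWith slot).Rm k
      + P.logFl h' V)

/-- **RESIDUAL R3D-02 `Fibre57Low` — the LOWER step bound at the trivial history, «THE χ_(4)-VARIANT OF (57)»** ([Balaban1985UV3] p. 265
L21–28 «Let us make a remark about a lower bound … we perform the same operations on the whole lattice as on the sets Ω₁»; p. 272 L32–33 «The lower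
bound is proved in the same way, with all simplifications coming from the fact that Ω_{k+1} = T_η»), in TRANSPORTED form at the lane's standard tower:
`χ_{k+1}·exp[(57) exponent at triv] ≤ T_k[χ_k·exp((47)_k exponent at triv)]` dV-a.e.  LABEL (lead ruling R-CHI (ii), batch 33): BOTH `χ`'s here are
the run's function of (4) — the restriction `|V(∂p) − 1| < ε₁` on the level-`k` resp. level-`(k+1)` FIELD (`RunObjects.chi`, `eps1Of`) — whereas print
states (47)/(57) at the where-clause function `χ_k` of p. 267 L19–20 «χ_k corresponds to the restrictions on V given by the conditions
|U_k(∂p) − 1| < g_kp(g_k)η²» (the MINIMIZER's plaquettes); the typed statement follows from print's (57)[χ_k] only modulo the two inclusions G3D-09 typed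
in the tree (`Literature.MathematicalPhysics.QuantumFieldTheory.Balaban1985CMP102.SectBLowerBound`: `SectB.TowerObjects.Chi47SubChi4` at `k`,
`Chi4SubChi47` at `k+1` — [7] Thm 1 regularity, LATENT rows) — a lane statement STRONGER than print's display by exactly that identification, not a
verbatim ρ-display.  A (β) ρ-display ASSUMED, not proved (status RESIDUAL).  Consistency with R3D-01 at `h′ = triv`: `…Proofs.FibreClash` (the pair pins
`T_k[χ_k·G] = e^F` a.e. on `{χ_{k+1} = 1}`; no contradiction at χB-threshold `ε₁`). [cite: Balaban1985UV3, p.265 L21–28 + (47) p.267 + p.272 L32–33] -/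
def Fibre57Low (P : StepPieces ((stdTowerInput X K 𝔖).towerWith slot).toTowerRun k) : Prop :=
  (fun V => ((stdTowerInput X K 𝔖).towerWith slot).chi (k + 1) V *
      Real.exp (-(((stdTowerInput X K 𝔖).towerWith slot).mainT (k + 1) (Hist.triv S.P (k + 1)) V)
        - ((stdTowerInput X K 𝔖).towerWith slot).Ecst k
        + (P.logσ₀ + P.dg * Real.log (S.gk k)) * P.starB (Hist.triv S.P (k + 1)) + P.logZU (Hist.triv S.P (k + 1)) V
        + P.Pold (Hist.triv S.P (k + 1)) V - ((stdTowerInput X K 𝔖).towerWith slot).Rm k + P.logFl (Hist.triv S.P (k + 1)) V))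
    ≤ᵐ[fieldMeasure S.P (k + 1) G] rnTransport (X.av k).avg (fun U => ((stdTowerInput X K 𝔖).towerWith slot).chi k U *
      Real.exp (-(((stdTowerInput X K 𝔖).towerWith slot).mainT k (Hist.triv S.P k) U) + (stdTowerInput X K 𝔖).Pint k (Hist.triv S.P k) U
        - ((stdTowerInput X K 𝔖).towerWith slot).Ecst k - ((stdTowerInput X K 𝔖).towerWith slot).Rm k))

/-! ## The closing terms: C1/C2 from the residuals, everything else discharged -/

omit [RegularGaugeGroup G] in
/-- **`lower_k ≤ upper_k` POINTWISE at the standard tower** (the `hlu` of seat p1's `run3_rho_succ_sandwich`/`run3_rho_succ_le_upper`), for pieces `P`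
whose barrier pinnings hold (`hupper`, `hlower`: `rfl`/`stdTowerInput_upper`/`_lower` for seat p3's pieces) and `Rm_k ≥ 0` (`hRm`: the booked
remainder coefficients `rcoefOf = CR·g^{6+2κ₀}` are non-negative for `CR ≥ 0`); the trivial-history mass is `1` by p1's pin `massRec_triv`.
[cite: Balaban1985UV3, (47) p.267 + p.272 L32–33] -/
theorem lower_le_upper_std (P : StepPieces ((stdTowerInput X K 𝔖).towerWith slot).toTowerRun k)
    (hRm : 0 ≤ ((stdTowerInput X K 𝔖).towerWith slot).Rm k)
    (hupper : ∀ V, (stdTowerInput X K 𝔖).upper k V =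
      ((stdTowerInput X K 𝔖).towerWith slot).LF (k + 1) V (fun h' =>
        -(((stdTowerInput X K 𝔖).towerWith slot).mainT (k + 1) h' V) - ((stdTowerInput X K 𝔖).towerWith slot).Ecst k
          + (P.logσ₀ + P.dg * Real.log (S.gk k)) * P.starB h' + P.logZU h' V + P.Pold h' V
          + ((stdTowerInput X K 𝔖).towerWith slot).Zterm k (P.proj h') + ((stdTowerInput X K 𝔖).towerWith slot).Rm k
          + P.logFl h' V))
    (hlower : ∀ V, (stdTowerInput X K 𝔖).lower k V = ((stdTowerInput X K 𝔖).towerWith slot).chi (k + 1) V *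
        Real.exp (-(((stdTowerInput X K 𝔖).towerWith slot).mainT (k + 1) (Hist.triv S.P (k + 1)) V)
          - ((stdTowerInput X K 𝔖).towerWith slot).Ecst k
          + (P.logσ₀ + P.dg * Real.log (S.gk k)) * P.starB (Hist.triv S.P (k + 1)) + P.logZU (Hist.triv S.P (k + 1)) V
          + P.Pold (Hist.triv S.P (k + 1)) V - ((stdTowerInput X K 𝔖).towerWith slot).Rm k + P.logFl (Hist.triv S.P (k + 1)) V))
    (V : GaugeField S.P (k + 1) G) :
    (stdTowerInput X K 𝔖).lower k V ≤ (stdTowerInput X K 𝔖).upper k V := by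
  rw [hlower V, hupper V]
  exact lower57_le_upper55 (stdTowerInput X K 𝔖) slot k P (stdTowerInput_mass_triv X K 𝔖 (k + 1)) hRm V


/-- **C1 AT THE STANDARD TOWER**: LQB's `Bound55 P` for any step pieces `P` over `(stdTowerInput X K 𝔖).towerWith slot` (seat p3's
`Inputs.piecesW` is such a `P`, with `hupper` by p1's `stdTowerInput_upper`), from: the threshold ordering `εL ≤ εS` of the decomposition of
unity AT THIS STEP (`hLS : eps1Of S K k ≤ epsSOf S K k`, (7)/(40); seat p3's `eps1Of_le_epsSOf`, `k ≤ K`), the integrability of the (41)_k summands (`hint`), the upper-barrier pinning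
(`hupper`), the lower-barrier pinning and `Rm_k ≥ 0` (for `lower ≤ upper`, so that seat p1's ONE-SIDED selection `run3_rho_succ_le_upper` (v1.3, R-SEL (a)) applies),
and — THE (β) CONTENT — the RESIDUAL R3D-01 `Fibre49` for every new history `h′` (the per-history fibre inequality
`hfibre` («The integral (49)» ≤ (55)·(58), pp. 268–270; (13)–(22) at k = 0, pp. 259–261) with the lane's CONCRETE weights: step weight
`stepWeight K.M₁ (rcolOf S K) (eps1Of S K) (epsSOf S K) k h′`, small-field factor `chiB K.M₁ (rcolOf S K) (eps1Of S K) k h′` (v4: at the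
decomposition threshold `eps1Of`, p. 267 L35–37 / p. 268 L13–15), masses
`histWeights3 …`.  Discharged inside: `hcover` (`histWeights3_cover`), `hm₁` (`histWeights3_transport_le_mass_ae`), `havg`/`hmap`
(`X.av_meas`/`X.av_map`). [cite: Balaban1985UV3, (48)–(49) pp.267–268 + (55) p.269 + (58) p.270] -/
theorem bound55_std (P : StepPieces ((stdTowerInput X K 𝔖).towerWith slot).toTowerRun k)
    (hLS : eps1Of S K k ≤ epsSOf S K k)
    (hint : ∀ h : Hist S.P k, Integrable (fun U => (stdTowerInput X K 𝔖).W.mass k h U *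
      Real.exp (-(((stdTowerInput X K 𝔖).towerWith slot).mainT k h U) + (stdTowerInput X K 𝔖).Pint k h U
        - ((stdTowerInput X K 𝔖).towerWith slot).Ecst k
        + ((stdTowerInput X K 𝔖).towerWith slot).Zterm k h + ((stdTowerInput X K 𝔖).towerWith slot).Rm k)) (fieldMeasure S.P k G))
    (hfibre : ∀ h' : Hist S.P (k + 1), Fibre49 X K 𝔖 slot k P h')
    (hupper : ∀ V, (stdTowerInput X K 𝔖).upper k V =
      ((stdTowerInput X K 𝔖).towerWith slot).LF (k + 1) V (fun h' =>
        -(((stdTowerInput X K 𝔖).towerWith slot).mainT (k + 1) h' V) - ((stdTowerInput X K 𝔖).towerWith slot).Ecst k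
          + (P.logσ₀ + P.dg * Real.log (S.gk k)) * P.starB h' + P.logZU h' V + P.Pold h' V
          + ((stdTowerInput X K 𝔖).towerWith slot).Zterm k (P.proj h') + ((stdTowerInput X K 𝔖).towerWith slot).Rm k
          + P.logFl h' V))
    (hlower : ∀ V, (stdTowerInput X K 𝔖).lower k V = ((stdTowerInput X K 𝔖).towerWith slot).chi (k + 1) V *
        Real.exp (-(((stdTowerInput X K 𝔖).towerWith slot).mainT (k + 1) (Hist.triv S.P (k + 1)) V)
          - ((stdTowerInput X K 𝔖).towerWith slot).Ecst k
          + (P.logσ₀ + P.dg * Real.log (S.gk k)) * P.starB (Hist.triv S.P (k + 1)) + P.logZU (Hist.triv S.P (k + 1)) V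
          + P.Pold (Hist.triv S.P (k + 1)) V - ((stdTowerInput X K 𝔖).towerWith slot).Rm k + P.logFl (Hist.triv S.P (k + 1)) V))
    (hRm : 0 ≤ ((stdTowerInput X K 𝔖).towerWith slot).Rm k) :
    Bound55 P :=
  bound55_of_select (stdTowerInput X K 𝔖) slot k P (X.av_meas k) (X.av_map k)
    (stepWeight K.M₁ (rcolOf S K) (eps1Of S K) (epsSOf S K) k) (chiB K.M₁ (rcolOf S K) (eps1Of S K) k)
    (measurable_stepWeight K.M₁ (rcolOf S K) (eps1Of S K) (epsSOf S K) k)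
    (stepWeight_nonneg K.M₁ (rcolOf S K) (eps1Of S K) (epsSOf S K) k)
    (stepWeight_le_one K.M₁ (rcolOf S K) (eps1Of S K) (epsSOf S K) k)
    (measurable_chiB K.M₁ (rcolOf S K) (eps1Of S K) k)
    (chiB_nonneg K.M₁ (rcolOf S K) (eps1Of S K) k)
    (chiB_le_one K.M₁ (rcolOf S K) (eps1Of S K) k)
    (histWeights3_cover K.M₁ (rcolOf S K) (eps1Of S K) (epsSOf S K) X.av k hLS)
    (histWeights3_transport_le_mass_ae K.M₁ (rcolOf S K) (eps1Of S K) (epsSOf S K) X.av k (X.av_meas k) (X.av_map k))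
    hint hfibre hupper
    (fun hae W => run3_rho_succ_le_upper ((stdTowerInput X K 𝔖).toRunInput slot) k hae
      (lower_le_upper_std X K 𝔖 slot k P hRm hupper hlower) W)

/-- **C2 AT THE STANDARD TOWER**: LQB's `Bound55Lower P` over `(stdTowerInput X K 𝔖).towerWith slot` from the integrability of the
(47)_k left-hand side (`hint47`), the lower-barrier pinning (`hlower`: p1's `stdTowerInput_lower` for seat p3's pieces), seat p1's one-sided
selection `run3_lower_le_rho_succ` (v1.3), and — THE (β) CONTENT — the RESIDUAL R3D-02 `Fibre57Low` (the trivial-history fibre inequality `hfibreLow` (p. 265 L21–28 / p. 272 L32–33).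
[cite: Balaban1985UV3, p.265 L21–28 + (47) p.267 + p.272 L32–33] -/
theorem bound55Lower_std (P : StepPieces ((stdTowerInput X K 𝔖).towerWith slot).toTowerRun k)
    (hint47 : Integrable (fun U => ((stdTowerInput X K 𝔖).towerWith slot).chi k U *
      Real.exp (-(((stdTowerInput X K 𝔖).towerWith slot).mainT k (Hist.triv S.P k) U) + (stdTowerInput X K 𝔖).Pint k (Hist.triv S.P k) U
        - ((stdTowerInput X K 𝔖).towerWith slot).Ecst k - ((stdTowerInput X K 𝔖).towerWith slot).Rm k)) (fieldMeasure S.P k G))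
    (hfibreLow : Fibre57Low X K 𝔖 slot k P)
    (hlower : ∀ V, (stdTowerInput X K 𝔖).lower k V = ((stdTowerInput X K 𝔖).towerWith slot).chi (k + 1) V *
        Real.exp (-(((stdTowerInput X K 𝔖).towerWith slot).mainT (k + 1) (Hist.triv S.P (k + 1)) V)
          - ((stdTowerInput X K 𝔖).towerWith slot).Ecst k
          + (P.logσ₀ + P.dg * Real.log (S.gk k)) * P.starB (Hist.triv S.P (k + 1)) + P.logZU (Hist.triv S.P (k + 1)) V
          + P.Pold (Hist.triv S.P (k + 1)) V - ((stdTowerInput X K 𝔖).towerWith slot).Rm k + P.logFl (Hist.triv S.P (k + 1)) V))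
    : Bound55Lower P :=
  bound55Lower_of_select (stdTowerInput X K 𝔖) slot k P (X.av_meas k) (X.av_map k) hint47 hfibreLow hlower
    (fun hae W => run3_lower_le_rho_succ ((stdTowerInput X K 𝔖).toRunInput slot) k hae W)

/-! ## The integrability side conditions `hint`/`hint47` from primitive facts (lead batch 21 (e)) -/

omit [HaarData G] [RegularGaugeGroup G] in
/-- `A^η ≥ 0` ((5) p. 256: `A^η(U) = Σ_p η⁻¹[1 − Re tr U(∂p)]` with `η = L^{−k} > 0` and `Re tr ≤ 1`). [cite: Balaban1985UV3, (5) p.256] -/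
theorem actionEta_nonneg [RegularGaugeGroup G] (k : ℕ) (U : GaugeField S.P 0 G) : 0 ≤ S.actionEta k U := by
  unfold Scales.actionEta wilsonAction
  refine Finset.sum_nonneg fun p _ => mul_nonneg (inv_nonneg.mpr ?_) ?_
  · unfold Scales.eta Params.eta; positivity
  · have := (abs_le.mp (RegularGaugeGroup.abs_reTr_le_one (GaugeField.plaqHol U p))).2; linarith

omit [HaarData G] [RegularGaugeGroup G] in
/-- `A^η` is a measurable function of the field (`Re tr` and the plaquette variables are measurable). [folklore] -/
theorem measurable_actionEta [RegularGaugeGroup G] (k : ℕ) : Measurable (S.actionEta k : GaugeField S.P 0 G → ℝ) := by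
  unfold Scales.actionEta wilsonAction
  refine Finset.measurable_sum _ fun p _ => ?_
  exact measurable_const.mul (measurable_const.sub (RegularGaugeGroup.measurable_reTr.comp (Missing.measurable_plaqHol p)))

/-- **`hint` DERIVED** (lead batch 21 (e)): the (41)_k summand `m_k(h)·exp[−(1/g_k²)A^η(U_k(·,h)) + Σ𝒫 − E_k + Z-terms + remainders]` is integrable
on `dU_k` as soon as (ii) the minimizer map `U_k(·, h) = X.UkH k h` of [7] is MEASURABLE (an EXTERNAL-input property) and (iii) the interaction
sum `Pint k h` of (43) is MEASURABLE and BOUNDED ABOVE (data regularity of the activities); (i) `A^η ≥ 0` (`actionEta_nonneg`), the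
measurability of `A^η` and of the masses (p1 `measurable_massRec`) are lane theorems — `Transport48.integrable_weight_mul_exp`. [folklore] -/
theorem hint_std (hU : ∀ h : Hist S.P k, Measurable ((stdTowerInput X K 𝔖).UkH k h))
    (hPm : ∀ h : Hist S.P k, Measurable ((stdTowerInput X K 𝔖).Pint k h)) (cP : ℝ)
    (hPb : ∀ (h : Hist S.P k) (U : GaugeField S.P k G), (stdTowerInput X K 𝔖).Pint k h U ≤ cP) (h : Hist S.P k) :
    Integrable (fun U => (stdTowerInput X K 𝔖).W.mass k h U *
      Real.exp (-(((stdTowerInput X K 𝔖).towerWith slot).mainT k h U) + (stdTowerInput X K 𝔖).Pint k h U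
        - ((stdTowerInput X K 𝔖).towerWith slot).Ecst k
        + ((stdTowerInput X K 𝔖).towerWith slot).Zterm k h + ((stdTowerInput X K 𝔖).towerWith slot).Rm k)) (fieldMeasure S.P k G) := by
  have hmain : ∀ U, ((stdTowerInput X K 𝔖).towerWith slot).mainT k h U
      = (S.gk k)⁻¹ ^ 2 * S.actionEta k ((stdTowerInput X K 𝔖).UkH k h U) := fun _ => rfl
  refine Transport48.integrable_weight_mul_exp (stdTowerInput_mass_measurable X K 𝔖 k h)
    ((stdTowerInput X K 𝔖).W.mass_nonneg k h) ((stdTowerInput X K 𝔖).W.mass_le_one k h) ?_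
    (c := cP - ((stdTowerInput X K 𝔖).towerWith slot).Ecst k
      + ((stdTowerInput X K 𝔖).towerWith slot).Zterm k h + ((stdTowerInput X K 𝔖).towerWith slot).Rm k) ?_
  · simp_rw [hmain]
    exact ((((measurable_const.mul ((measurable_actionEta (S := S) k).comp (hU h))).neg.add (hPm h)).sub measurable_const).add
      measurable_const).add measurable_const
  · intro U
    have h0 : 0 ≤ ((stdTowerInput X K 𝔖).towerWith slot).mainT k h U := by
      rw [hmain]; exact mul_nonneg (sq_nonneg _) (actionEta_nonneg (S := S) k _)
    have h1 := hPb h U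
    linarith

/-- **`hint47` DERIVED** likewise: the (47)_k left-hand side `χ_k·exp[−(1/g_k²)A^η(U_k) + Σ𝒫(triv) − E_k − remainders]` is integrable on `dU_k`
from the measurability of `U_k(·, triv)` and the measurability + upper bound of `Pint k triv` (`χ_k ∈ [0,1]` measurable by LQB
`T4AxialGaugeFixing.measurable_chiSmall`). [folklore] -/
theorem hint47_std (hU : Measurable ((stdTowerInput X K 𝔖).UkH k (Hist.triv S.P k)))
    (hPm : Measurable ((stdTowerInput X K 𝔖).Pint k (Hist.triv S.P k))) (cP : ℝ)
    (hPb : ∀ U : GaugeField S.P k G, (stdTowerInput X K 𝔖).Pint k (Hist.triv S.P k) U ≤ cP) :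
    Integrable (fun U => ((stdTowerInput X K 𝔖).towerWith slot).chi k U *
      Real.exp (-(((stdTowerInput X K 𝔖).towerWith slot).mainT k (Hist.triv S.P k) U) + (stdTowerInput X K 𝔖).Pint k (Hist.triv S.P k) U
        - ((stdTowerInput X K 𝔖).towerWith slot).Ecst k - ((stdTowerInput X K 𝔖).towerWith slot).Rm k)) (fieldMeasure S.P k G) := by
  have hmain : ∀ U, ((stdTowerInput X K 𝔖).towerWith slot).mainT k (Hist.triv S.P k) U
      = (S.gk k)⁻¹ ^ 2 * S.actionEta k ((stdTowerInput X K 𝔖).UkH k (Hist.triv S.P k) U) := fun _ => rfl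
  have hchi : ((stdTowerInput X K 𝔖).towerWith slot).chi k = chiSmall Set.univ ((stdTowerInput X K 𝔖).ε₁ k) := rfl
  refine Transport48.integrable_weight_mul_exp ?_ ?_ ?_ ?_
    (c := cP - ((stdTowerInput X K 𝔖).towerWith slot).Ecst k - ((stdTowerInput X K 𝔖).towerWith slot).Rm k) ?_
  · rw [hchi]; exact T4AxialGaugeFixing.measurable_chiSmall _ _
  · intro U; rw [hchi]; unfold chiSmall; split_ifs <;> norm_num
  · intro U; rw [hchi]; unfold chiSmall; split_ifs <;> norm_num
  · simp_rw [hmain]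
    exact (((measurable_const.mul ((measurable_actionEta (S := S) k).comp hU)).neg.add hPm).sub measurable_const).sub
      measurable_const
  · intro U
    have h0 : 0 ≤ ((stdTowerInput X K 𝔖).towerWith slot).mainT k (Hist.triv S.P k) U := by
      rw [hmain]; exact mul_nonneg (sq_nonneg _) (actionEta_nonneg (S := S) k _)
    have h1 := hPb U
    linarith

end Summit.QuantumFields.Balaban3D.Proofs.Bound55Std

end
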